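import Mathlib
import HarnessLib
import Summits.HubbardSuperconductivity.HubbardSuperconductivity.Theorems.KLProgrammeKLRegimeSplitPredicatesV2
import Summits.HubbardSuperconductivity.HubbardSuperconductivity.Theorems.KLProgrammeSWaveCascadeBridge

/-!
# Route `KLProgramme` — row 0′ of the K3 supplier map ON THE V2 NAMES: the pair-class ladder part of (B1-v2)
# `PairArrayAt` from (E2-v2) `PairLadderStepAt` at every scale `≤ n`

Cell gate-hubbard-kl, seat p3.  For a total momentum `Q` in the pair class at scale `n` (hence at every `j ≤ n`), the engine's
one-scale ladder steps `PairLadderStepAt … j` (`KLProgrammeKLRegimeSplitPredicatesV2.lean`, p1: weights `w_j ≥ 0` of mass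
`≤ bhi`, a right inverse `N_j` of `1 + diag(w_j)·𝒞_{j-1}(Q)`, and `|𝒞_j(Q;k,k') - (𝒞_{j-1}(Q)·N_j)(k,k')| ≤ drivePBar(j-1) + ē_{j-1}` on
the ball) are converted (`KLProgrammeSWaveCascadeBridge`) into the implicit weighted-product steps of
`KLProgrammeSWaveCascadeVarying` on the ball carrier `↥(klBall L μ K)`, with the exact repulsive s-wave cascade started at the
bare value `U ≥ 0` (the `n = 0` clause: `|𝒞_0 - U| ≤ initDevBar`), and `sWaveCascade_envelope_varying` (with a bootstrap on the
size of the arrays, which enters the tails through `Δ_j ∗_w 𝒞_{j-1}`) yields **`pairLadder_envelope`**: a constant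
`u = U_n ∈ [0, U]` with `|𝒞_n(Q;k,k') - u| ≤ 8·(initDevBar + 2·Σ_{j<n}(drivePBar j + ē_j))` on the ball — i.e. (B1-v2)'s clause
for pair-class `Q` with `C_W·U²` := that majorant, under the two smallness conditions (the regime's `c ≤ c₀`: `Σ_j W_j ≤ bhi·n`,
`n ≤ n_β ≍ c/(U² ln 4)`, all sizes `O(U²)`).  Total momenta that have LEFT the pair class are handled by the frozen increments
(E2″-v2) — not in this file.  Everything is proved; no definitions.
-/

noncomputable section

namespace Summit.HubbardSuperconductivity.HubbardSuperconductivity.Theorems.KLRegimeSplit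

set_option linter.dupNamespace false -- summit = problem name (single-conjunct summit), D-0017

open Finset Literature.MathematicalPhysics.QuantumLattice Literature.Probability.LatticeModels
open Summit.HubbardSuperconductivity.HubbardSuperconductivity.Theorems.KLProgrammeLegKernels
open Summit.HubbardSuperconductivity.HubbardSuperconductivity.Theorems.CooperChannelRiccatiFlow
open Summit.HubbardSuperconductivity.HubbardSuperconductivity.Theorems.SWaveCascade

section Model

variable (L M : ℕ) [NeZero L] [NeZero M]

omit [NeZero L] [NeZero M] in
/-- Pair classes are nested: `|p_Q|_𝕋 ≤ 4^{-n} ≤ 4^{-j}` for `j ≤ n`. -/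
theorem isPairClassAt_mono {Q : TorusSite 2 L} {j n : ℕ} (h : IsPairClassAt L Q n) (hjn : j ≤ n) : IsPairClassAt L Q j := by
  unfold IsPairClassAt at h ⊢
  refine h.trans ?_
  exact inv_anti₀ (by positivity) (pow_le_pow_right₀ (by norm_num) hjn)

/-- Entries of the truncated pair array on the ball. -/
theorem klPairArray_apply_of_mem (β U μ : ℝ) (K : TrigPolyC4v) (n : ℕ) (Q : TorusSite 2 L) {k k' : TorusSite 2 L}
    (hk : k ∈ klBall L μ K) (hk' : k' ∈ klBall L μ K) :
    klPairArray L M β U μ K n Q k k' = klPairAmplitude L M β U μ K n Q k k' := by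
  simp [klPairArray, hk, hk']

/-- The truncated pair array vanishes off the ball (first index). -/
theorem klPairArray_apply_of_not_mem (β U μ : ℝ) (K : TrigPolyC4v) (n : ℕ) (Q : TorusSite 2 L) {k : TorusSite 2 L}
    (hk : k ∉ klBall L μ K) (k' : TorusSite 2 L) : klPairArray L M β U μ K n Q k k' = 0 := by
  simp [klPairArray, hk]

variable {G : GeoConsts} {P : SplitConsts} {Qc : EngConsts}

/-- `ē_n ≥ 0`. -/
theorem eremBar_nonneg' (hG : G.WF) (hP : P.WF) (hQ : Qc.WF) (U β : ℝ) (L' n : ℕ) : 0 ≤ eremBar G P Qc U β L' n := by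
  obtain ⟨-, -, -, -, hcloc, -, -, -, -, -, -, -, -, -, -, -, -, -, -, -⟩ := hG
  obtain ⟨hK, -, -⟩ := hP
  obtain ⟨-, hCR, -, -, -, -, -, hCL⟩ := hQ
  have hK0 : 0 ≤ P.Klam := zero_le_one.trans hK
  unfold eremBar
  have h1 : 0 ≤ G.cloc * (P.Klam * U) ^ 2 * (4 : ℝ) ^ (-(G.θ * n)) :=
    mul_nonneg (mul_nonneg hcloc (sq_nonneg _)) (Real.rpow_nonneg (by norm_num) _)
  have h2 : 0 ≤ Qc.CR * (P.Klam * |U|) ^ 3 * ((2 : ℝ) ^ n)⁻¹ := by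
    have : 0 ≤ P.Klam * |U| := mul_nonneg hK0 (abs_nonneg U)
    positivity
  have h3 : 0 ≤ Qc.CL β n / L' := div_nonneg (hCL β n) (Nat.cast_nonneg L')
  linarith

/-- `drivePBar ≥ 0`. -/
theorem drivePBar_nonneg' (hG : G.WF) (U : ℝ) (n : ℕ) : 0 ≤ drivePBar G P U n := by
  obtain ⟨-, -, -, -, -, -, -, -, hζ, -, haplus, -⟩ := hG
  unfold drivePBar
  exact mul_nonneg (mul_nonneg haplus (sq_nonneg _)) (hζ n)

/-- **Row 0′ on the v2 names (pair-class part of (B1-v2)).**  See the module docstring. -/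
theorem pairLadder_envelope (hG : G.WF) (hP : P.WF) (hQc : Qc.WF) {β U μ : ℝ} {K : TrigPolyC4v} (hU : 0 ≤ U) {n : ℕ}
    (hsteps : ∀ j ≤ n, PairLadderStepAt L M G P Qc β U μ K j) {Qm : TorusSite 2 L} (hQm : IsPairClassAt L Qm n)
    (hsmall₁ : G.bhi * (U + 8 * (initDevBar G U +
      2 * ∑ j ∈ range n, (drivePBar G P U j + eremBar G P Qc U β L j))) ≤ 1)
    (hsmall₂ : 8 * 16 * (initDevBar G U + 2 * ∑ j ∈ range n, (drivePBar G P U j + eremBar G P Qc U β L j)) *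
      (G.bhi * n) ≤ 1) :
    ∃ u : ℝ, 0 ≤ u ∧ u ≤ U ∧ ∀ k ∈ klBall L μ K, ∀ k' ∈ klBall L μ K,
      ‖klPairAmplitude L M β U μ K n Qm k k' - (u : ℂ)‖ ≤
        8 * (initDevBar G U + 2 * ∑ j ∈ range n, (drivePBar G P U j + eremBar G P Qc U β L j)) := by
  classical
  -- notation
  set B : Finset (TorusSite 2 L) := klBall L μ K with hB
  set τ : ℕ → ℝ := fun j => drivePBar G P U j + eremBar G P Qc U β L j with hτ
  have hτ0 : ∀ j, 0 ≤ τ j := fun j => add_nonneg (drivePBar_nonneg' hG U j) (eremBar_nonneg' hG hP hQc U β L j)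
  set A : ℝ := initDevBar G U + 2 * ∑ j ∈ range n, τ j with hA
  have hbhi : 0 ≤ G.bhi := hG.2.2.1.trans hG.2.2.2.1
  have hinit0 : 0 ≤ initDevBar G U := by
    unfold initDevBar
    refine mul_nonneg (add_nonneg (sum_nonneg fun χ _ => add_nonneg (hG.2.1 χ) (hG.1 χ)) zero_le_one) (sq_nonneg U)
  have hA0 : 0 ≤ A := add_nonneg hinit0 (mul_nonneg (by norm_num) (sum_nonneg fun j _ => hτ0 j))
  set C : ℕ → Matrix (TorusSite 2 L) (TorusSite 2 L) ℂ := fun i => klPairArray L M β U μ K i Qm with hC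
  have hCsupp : ∀ i u, u ∉ B → ∀ t, C i u t = 0 := fun i u hu t => klPairArray_apply_of_not_mem L M β U μ K i Qm hu t
  -- the step data, indexed by the SOURCE scale `i` (step `i → i+1`)
  have hex : ∀ i, i < n → ∃ w : TorusSite 2 L → ℝ, (∀ p, 0 ≤ w p) ∧ (∑ p, w p ≤ G.bhi) ∧
      ∃ N : Matrix (TorusSite 2 L) (TorusSite 2 L) ℂ, (1 + Matrix.diagonal (fun p => (w p : ℂ)) * C i) * N = 1 ∧
        ∀ k ∈ B, ∀ k' ∈ B, ‖klPairAmplitude L M β U μ K (i + 1) Qm k k' - (C i * N) k k'‖ ≤ τ i := by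
    intro i hi
    have h := (hsteps (i + 1) (Nat.succ_le_of_lt hi)).2 (Nat.le_add_left 1 i) Qm
      (isPairClassAt_mono L hQm (Nat.succ_le_of_lt hi))
    simp only [Nat.add_sub_cancel] at h
    exact h
  choose! wt hwt0 hwtsum Nm hNm happ using hex
  -- the matrices Δ, T and the full-carrier implicit step
  set Δ : ℕ → Matrix (TorusSite 2 L) (TorusSite 2 L) ℂ := fun i => C (i + 1) - C i * Nm i with hΔ
  set T : ℕ → Matrix (TorusSite 2 L) (TorusSite 2 L) ℂ :=
    fun i => Δ i + Δ i * Matrix.diagonal (fun p => (wt i p : ℂ)) * C i with hT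
  have hfull : ∀ i < n, C (i + 1) = C i - C (i + 1) * Matrix.diagonal (fun p => (wt i p : ℂ)) * C i + T i :=
    fun i hi => implicit_step_of_rightInverse (wt i) (hNm i hi) (by simp only [hΔ]; abel)
  -- restriction to the ball
  set 𝒞r : ℕ → ↥B → ↥B → ℂ := fun i => resArr B (C i) with h𝒞r
  -- weights on the ball; junk steps `i ≥ n` get weight `0`
  set wr : ℕ → ↥B → ℝ := fun i u => if i < n then wt i u.1 else 0 with hwr
  set Tr : ℕ → ↥B → ↥B → ℂ := fun i => resArr B (T i) with hTr
  have hwr_eq : ∀ i < n, wr i = fun u : ↥B => wt i u.1 := fun i hi => funext fun u => if_pos hi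
  have hwr0 : ∀ i u, 0 ≤ wr i u := by
    intro i u
    by_cases hi : i < n
    · rw [hwr_eq i hi]; exact hwt0 i hi u.1
    · simp [hwr, hi]
  have hWr : ∀ i < n, ∑ u, wr i u ≤ G.bhi := fun i hi => by
    rw [hwr_eq i hi]
    calc ∑ u : ↥B, wt i u.1 = ∑ u ∈ B, wt i u := Finset.sum_coe_sort B (wt i)
      _ ≤ ∑ u, wt i u := sum_le_sum_of_subset_of_nonneg (subset_univ B) fun u _ _ => hwt0 i hi u
      _ ≤ G.bhi := hwtsum i hi
  have hstepr : ∀ i < n, 𝒞r (i + 1) = 𝒞r i - wmul (wr i) (𝒞r (i + 1)) (𝒞r i) + Tr i := by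
    intro i hi
    funext k k'
    have h := congrFun (congrFun (hfull i hi) k.1) k'.1
    have hw := congrFun (congrFun (resArr_wmul B (wt i) (C (i + 1)) (C i) (hCsupp i)) k) k'
    rw [← hwr_eq i hi] at hw
    simp only [resArr] at hw
    rw [Matrix.add_apply, Matrix.sub_apply, mul_diagonal_mul_apply_eq_wmul, hw] at h
    simp only [h𝒞r, hTr, Pi.add_apply, Pi.sub_apply, resArr]
    exact h
  -- the repulsive scalar cascade on the ball
  obtain ⟨Us, hUs0, hUss⟩ : ∃ Us : ℕ → ℝ, Us 0 = U ∧ ∀ i, Us (i + 1) = Us i / (1 + (∑ u, wr i u) * Us i) :=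
    ⟨fun i => Nat.rec U (fun i u => u / (1 + (∑ v, wr i v) * u)) i, rfl, fun i => rfl⟩
  -- initial data
  have h𝒟0 : esup (𝒞r 0 - ((Us 0 : ℝ) : ℂ) • onesArr) ≤ initDevBar G U := by
    rw [hUs0]
    refine esup_le (fun k k' => ?_) hinit0
    have h0 := (hsteps 0 (Nat.zero_le n)).1 rfl Qm (isPairClassAt_mono L hQm (Nat.zero_le n)) k.1 k.2 k'.1 k'.2
    simpa [h𝒞r, resArr, hC, klPairArray_apply_of_mem L M β U μ K 0 Qm k.2 k'.2, onesArr] using h0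
  -- tail bound in terms of the size of the source array
  have hTr : ∀ i < n, esup (Tr i) ≤ τ i * (1 + G.bhi * esup (𝒞r i)) := by
    intro i hi
    have hΔr : esup (resArr B (Δ i)) ≤ τ i := by
      refine esup_resArr_le_of_forall B (hτ0 i) fun k hk k' hk' => ?_
      have := happ i hi k hk k' hk'
      simpa [hΔ, hC, klPairArray_apply_of_mem L M β U μ K (i + 1) Qm hk hk', Matrix.sub_apply] using this
    have hsplit : Tr i = resArr B (Δ i) + wmul (wr i) (resArr B (Δ i)) (𝒞r i) := by
      funext k k'
      have hw := congrFun (congrFun (resArr_wmul B (wt i) (Δ i) (C i) (hCsupp i)) k) k'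
      rw [← hwr_eq i hi] at hw
      simp only [resArr] at hw
      simp only [hTr, hT, h𝒞r, Pi.add_apply, resArr, Matrix.add_apply, mul_diagonal_mul_apply_eq_wmul, hw]
    rw [hsplit]
    refine (esup_add_le _ _).trans ?_
    have h2 := esup_wmul_le (wr i) (hwr0 i) (resArr B (Δ i)) (𝒞r i)
    have h3 : esup (resArr B (Δ i)) * (∑ u, wr i u) * esup (𝒞r i) ≤ τ i * G.bhi * esup (𝒞r i) :=
      mul_le_mul_of_nonneg_right (mul_le_mul hΔr (hWr i hi) (sum_nonneg fun u _ => hwr0 i u) (hτ0 i)) (esup_nonneg _)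
    nlinarith
  have hUs0' : 0 ≤ Us 0 := by rw [hUs0]; exact hU
  have hUss' : ∀ i, Us (i + 1) = Us i / (1 + (∑ u, wr i u) * 1 * Us i) := fun i => by rw [hUss i, mul_one]
  have hUs_nonneg : ∀ i, 0 ≤ Us i :=
    sWave_nonneg (U := Us) (W := 1) (b := fun i => ∑ u, wr i u) zero_le_one (fun i => sum_nonneg fun u _ => hwr0 i u)
      hUs0' hUss'
  have hUs_le : ∀ i, Us i ≤ U := fun i => by
    have := sWave_le_init (U := Us) (W := 1) (b := fun i => ∑ u, wr i u) zero_le_one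
      (fun i => sum_nonneg fun u _ => hwr0 i u) hUs0' hUss' i
    rwa [hUs0] at this
  have hCr_le : ∀ i, esup (𝒞r i) ≤ Us i + esup (𝒞r i - ((Us i : ℝ) : ℂ) • onesArr) := by
    intro i
    have : 𝒞r i = ((Us i : ℝ) : ℂ) • onesArr + (𝒞r i - ((Us i : ℝ) : ℂ) • onesArr) := by abel
    rw [this] 
    refine (esup_add_le _ _).trans (add_le_add ?_ (by rw [← this]))
    refine (esup_smul_le _ _).trans ?_
    rw [Complex.norm_real, Real.norm_eq_abs, abs_of_nonneg (hUs_nonneg i)]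
    refine mul_le_of_le_one_right (hUs_nonneg i) (esup_le (fun _ _ => by simp [onesArr]) zero_le_one)
  -- BOOTSTRAP: `esup 𝒟r m ≤ 8A` for all `m ≤ n`, by strong induction on the horizon
  have hboot : ∀ m ≤ n, esup (𝒞r m - ((Us m : ℝ) : ℂ) • onesArr) ≤ 8 * A := by
    intro m
    induction m using Nat.strong_induction_on with
    | _ m ih =>
      intro hm
      -- tails before `m`
      have hT2 : ∀ i < m, esup (Tr i) ≤ 2 * τ i := by
        intro i hi
        have hin : i < n := lt_of_lt_of_le hi hm
        have hDi := ih i hi hin.le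
        have hCi : esup (𝒞r i) ≤ U + 8 * A := (hCr_le i).trans (add_le_add (hUs_le i) hDi)
        have h1 := hTr i hin
        have h2 : G.bhi * esup (𝒞r i) ≤ 1 := by
          have : G.bhi * esup (𝒞r i) ≤ G.bhi * (U + 8 * A) := mul_le_mul_of_nonneg_left hCi hbhi
          exact this.trans hsmall₁
        nlinarith [hτ0 i]
      have hsm : 8 * 16 * (esup (𝒞r 0 - ((Us 0 : ℝ) : ℂ) • onesArr) + ∑ j ∈ range m, esup (Tr j)) *
          ∑ j ∈ range m, (∑ u, wr j u) ≤ 1 := by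
        refine le_trans ?_ hsmall₂
        have hsumT : ∑ j ∈ range m, esup (Tr j) ≤ 2 * ∑ j ∈ range n, τ j := by
          calc ∑ j ∈ range m, esup (Tr j) ≤ ∑ j ∈ range m, 2 * τ j := sum_le_sum fun j hj => hT2 j (mem_range.1 hj)
            _ = 2 * ∑ j ∈ range m, τ j := by rw [mul_sum]
            _ ≤ 2 * ∑ j ∈ range n, τ j :=
                mul_le_mul_of_nonneg_left (sum_le_sum_of_subset_of_nonneg (range_mono hm) fun j _ _ => hτ0 j) (by norm_num)
        have hsumW : ∑ j ∈ range m, (∑ u, wr j u) ≤ G.bhi * n := by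
          calc ∑ j ∈ range m, (∑ u, wr j u) ≤ ∑ j ∈ range m, G.bhi :=
                sum_le_sum fun j hj => hWr j (lt_of_lt_of_le (mem_range.1 hj) hm)
            _ = G.bhi * m := by rw [sum_const, card_range, nsmul_eq_mul, mul_comm]
            _ ≤ G.bhi * n := mul_le_mul_of_nonneg_left (by exact_mod_cast hm) hbhi
        have hW0 : 0 ≤ ∑ j ∈ range m, (∑ u, wr j u) := sum_nonneg fun j _ => sum_nonneg fun u _ => hwr0 j u
        have hfac : esup (𝒞r 0 - ((Us 0 : ℝ) : ℂ) • onesArr) + ∑ j ∈ range m, esup (Tr j) ≤ A := by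
          rw [hA]; exact add_le_add h𝒟0 hsumT
        have hfac0 : 0 ≤ esup (𝒞r 0 - ((Us 0 : ℝ) : ℂ) • onesArr) + ∑ j ∈ range m, esup (Tr j) :=
          add_nonneg (esup_nonneg _) (sum_nonneg fun j _ => esup_nonneg _)
        calc 8 * 16 * (esup (𝒞r 0 - ((Us 0 : ℝ) : ℂ) • onesArr) + ∑ j ∈ range m, esup (Tr j)) * ∑ j ∈ range m, (∑ u, wr j u)
            ≤ 8 * 16 * A * (G.bhi * n) := mul_le_mul (mul_le_mul_of_nonneg_left hfac (by norm_num)) hsumW hW0 (by positivity)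
          _ = 8 * 16 * (initDevBar G U + 2 * ∑ j ∈ range n, τ j) * (G.bhi * n) := by rw [hA]
      have hmain := sWaveCascade_envelope_varying (w := wr) hwr0 (𝒞 := 𝒞r) (T := Tr) (U := Us) (N := m)
        (by rw [hUs0]; exact hU) hUss (fun i hi => hstepr i (lt_of_lt_of_le hi hm)) hsm
      have := (hmain m le_rfl).2
      refine this.trans ?_
      have hsumT' : ∑ j ∈ range m, esup (Tr j) ≤ 2 * ∑ j ∈ range n, τ j := by
        calc ∑ j ∈ range m, esup (Tr j) ≤ ∑ j ∈ range m, 2 * τ j := sum_le_sum fun j hj => hT2 j (mem_range.1 hj)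
          _ = 2 * ∑ j ∈ range m, τ j := by rw [mul_sum]
          _ ≤ 2 * ∑ j ∈ range n, τ j :=
              mul_le_mul_of_nonneg_left (sum_le_sum_of_subset_of_nonneg (range_mono hm) fun j _ _ => hτ0 j) (by norm_num)
      rw [hA]
      linarith [h𝒟0]
  -- conclusion
  refine ⟨Us n, hUs_nonneg n, hUs_le n, fun k hk k' hk' => ?_⟩
  have hent := le_esup (𝒞r n - ((Us n : ℝ) : ℂ) • onesArr) ⟨k, hk⟩ ⟨k', hk'⟩
  have heq : (𝒞r n - ((Us n : ℝ) : ℂ) • onesArr : ↥B → ↥B → ℂ) ⟨k, hk⟩ ⟨k', hk'⟩ =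
      klPairAmplitude L M β U μ K n Qm k k' - ((Us n : ℝ) : ℂ) := by
    have h1 : 𝒞r n ⟨k, hk⟩ ⟨k', hk'⟩ = klPairAmplitude L M β U μ K n Qm k k' := by
      simp only [h𝒞r, resArr, hC]
      exact klPairArray_apply_of_mem L M β U μ K n Qm hk hk'
    simp only [Pi.sub_apply, Pi.smul_apply, smul_eq_mul, onesArr, mul_one, h1]
  rw [heq] at hent
  exact hent.trans ((hboot n le_rfl).trans (by rw [hA]))

end Model

end Summit.HubbardSuperconductivity.HubbardSuperconductivity.Theorems.KLRegimeSplit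

end
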